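import Summits.ABC.ABC.Theorems.RibetTakahashiSplitSubexpOfValuationProduct
import Summits.ABC.ABC.Theorems.RibetTakahashiSplitFewPrimeValuationProductOfPartsGlue
import HarnessLib

/-!
# Line `matveev-face-clearing` for crux `FewPrimeValuationProduct` (stmt-ABC-1563): the Frey part IS
# sub-exponential abc on triples with at most four prime factors

Support file (`--supports stmt-ABC-1563`, registered sub-goals `freyFewPrime_of_subexpFour`,
`subexpFour_of_freyFewPrime`). The Frey part of the crux r4 — `∏_{p ∣ abc} v_p(abc) ≤ K_ε rad^ε` for abc
triples supported on `≤ 4` primes — is EQUIVALENT, by elementary bookkeeping, to sub-exponential abc on the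
same triples: `log c ≤ κ_ε rad(abc)^ε`.

* `subexpFour_of_freyFewPrime`: `c ≤ rad^{∏ v_p}` (`le_radical_pow_prod_factorization`, glue C of the route,
  restricted), then `log rad ≤ rad^{ε/2}/(ε/2)`.
* `freyFewPrime_of_subexpFour`: with `≤ 4` prime factors `∏ v_p(abc) ≤ max(log(abc)/log 2, 1)^4`
  (`prod_factorization_le`), `log(abc) ≤ 3 log c ≤ 3 κ rad^{ε/4}`.

Consequence for the planner (see the lead's notes): modulo the LFL theorem, the crux decomposes as
`FewPrimeValuationProduct ⟺ SubexpABC|_{ω(abc) ≤ 4} ∧ NonFreyResidual`, where `SubexpABC|_{ω ≤ 4}` is the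
restriction of the open milestone `SubexpABC` (`∀ ε, BakerShapeBound ε 0`, item stmt-ABC-1569) to four-prime
triples — strictly between Stewart–Yu / Pasten 2024 Thm 1.4 (`log c ≪ min{P(a),P(b),P(c)}^{1+o(1)}`) and abc.
-/

-- `Summit.<Summit>.<Problem>`: for the single-conjunct summit `ABC` the duplicate `ABC.ABC` is mandated.
set_option linter.dupNamespace false

noncomputable section

namespace Summit.ABC.ABC.Theorems.FewPrimeValuationProduct

open scoped BigOperators
open Finset
open Literature.NumberTheory.DiophantineGeometry

/-- **Frey part ⟹ sub-exponential abc on four-prime triples.** If `∏_{p ∣ abc} v_p(abc) ≤ K_ε rad^ε` for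
every abc triple with `≤ 4` prime factors (all `ε > 0`), then `log c ≤ κ_ε rad^ε` for the same triples, with
`κ_ε = K_{ε/2}/(ε/2)`: `c ≤ abc ≤ rad^{∏ v_p}` and `log rad ≤ rad^{ε/2}/(ε/2)`. [folklore] -/
theorem subexpFour_of_freyFewPrime :
    (∀ ε : ℝ, 0 < ε → ∃ K : ℝ, ∀ a b c : ℕ, Literature.NumberTheory.DiophantineGeometry.IsABCTriple a b c →
      (a * b * c).primeFactors.card ≤ 4 →
      ((∏ p ∈ (a * b * c).primeFactors, (a * b * c).factorization p : ℕ) : ℝ) ≤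
        K * (Literature.NumberTheory.DiophantineGeometry.rad a b c : ℝ) ^ ε) →
    ∀ ε : ℝ, 0 < ε → ∃ κ : ℝ, ∀ a b c : ℕ, Literature.NumberTheory.DiophantineGeometry.IsABCTriple a b c →
      (a * b * c).primeFactors.card ≤ 4 →
      Real.log c ≤ κ * (Literature.NumberTheory.DiophantineGeometry.rad a b c : ℝ) ^ ε := by
  intro hVP ε hε
  obtain ⟨K, hK⟩ := hVP (ε / 2) (half_pos hε)
  refine ⟨K / (ε / 2), fun a b c habc hcard => ?_⟩
  have hKabc := hK a b c habc hcard
  obtain ⟨ha, hb, hsum, -⟩ := habc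
  have hc0 : 0 < c := by omega
  have hn0 : a * b * c ≠ 0 := Nat.mul_ne_zero (Nat.mul_ne_zero ha.ne' hb.ne') hc0.ne'
  rw [rad_def] at hKabc ⊢
  set n : ℕ := a * b * c
  set M : ℕ := ∏ p ∈ n.primeFactors, n.factorization p
  have hcn : c ≤ n := Nat.le_mul_of_pos_left c (Nat.mul_pos ha hb)
  have key : c ≤ UniqueFactorizationMonoid.radical n ^ M :=
    hcn.trans (Summit.ABC.ABC.Theorems.le_radical_pow_prod_factorization hn0)
  have hR1 : (1 : ℝ) ≤ ((UniqueFactorizationMonoid.radical n : ℕ) : ℝ) := by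
    exact_mod_cast Nat.radical_pos n
  have hcR : (c : ℝ) ≤ ((UniqueFactorizationMonoid.radical n : ℕ) : ℝ) ^ M := by
    exact_mod_cast key
  set R : ℝ := ((UniqueFactorizationMonoid.radical n : ℕ) : ℝ)
  have hR0 : (0 : ℝ) < R := one_pos.trans_le hR1
  have hlogR : 0 ≤ Real.log R := Real.log_nonneg hR1
  have hM0 : (0 : ℝ) ≤ (M : ℝ) := Nat.cast_nonneg M
  have hKR : 0 ≤ K * R ^ (ε / 2) := hM0.trans hKabc
  have h1 : Real.log c ≤ (M : ℝ) * Real.log R :=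
    calc Real.log c ≤ Real.log (R ^ M) := Real.log_le_log (by exact_mod_cast hc0) hcR
      _ = (M : ℝ) * Real.log R := Real.log_pow R M
  have h2 : Real.log R ≤ R ^ (ε / 2) / (ε / 2) := Real.log_le_rpow_div hR0.le (half_pos hε)
  calc Real.log c ≤ (M : ℝ) * Real.log R := h1
    _ ≤ K * R ^ (ε / 2) * Real.log R := mul_le_mul_of_nonneg_right hKabc hlogR
    _ ≤ K * R ^ (ε / 2) * (R ^ (ε / 2) / (ε / 2)) := mul_le_mul_of_nonneg_left h2 hKR
    _ = K / (ε / 2) * (R ^ (ε / 2) * R ^ (ε / 2)) := by ring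
    _ = K / (ε / 2) * R ^ ε := by rw [← Real.rpow_add hR0, add_halves]

/-- **Sub-exponential abc on four-prime triples ⟹ the Frey part.** If `log c ≤ κ_ε rad^ε` for every abc
triple with `≤ 4` prime factors (all `ε > 0`), then `∏_{p ∣ abc} v_p(abc) ≤ K_ε rad^ε` for the same triples:
`∏ v_p(abc) ≤ max(log(abc)/log 2, 1)^4` (four factors, each `≤ log(abc)/log 2`) and
`log(abc) ≤ 3 log c ≤ 3 κ_{ε/4} rad^{ε/4}`. [folklore] -/
theorem freyFewPrime_of_subexpFour :
    (∀ ε : ℝ, 0 < ε → ∃ κ : ℝ, ∀ a b c : ℕ, Literature.NumberTheory.DiophantineGeometry.IsABCTriple a b c →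
      (a * b * c).primeFactors.card ≤ 4 →
      Real.log c ≤ κ * (Literature.NumberTheory.DiophantineGeometry.rad a b c : ℝ) ^ ε) →
    ∀ ε : ℝ, 0 < ε → ∃ K : ℝ, ∀ a b c : ℕ, Literature.NumberTheory.DiophantineGeometry.IsABCTriple a b c →
      (a * b * c).primeFactors.card ≤ 4 →
      ((∏ p ∈ (a * b * c).primeFactors, (a * b * c).factorization p : ℕ) : ℝ) ≤
        K * (Literature.NumberTheory.DiophantineGeometry.rad a b c : ℝ) ^ ε := by
  intro hS ε hε
  obtain ⟨κ, hκ⟩ := hS (ε / 4) (by positivity)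
  set κ' : ℝ := max κ 1 with hκ'
  have hκ'1 : 1 ≤ κ' := le_max_right _ _
  have hκ'0 : 0 ≤ κ' := zero_le_one.trans hκ'1
  have hlog2 : 0 < Real.log 2 := Real.log_pos one_lt_two
  refine ⟨(3 * κ' / Real.log 2) ^ 4, fun a b c habc hcard => ?_⟩
  have hlogc := hκ a b c habc hcard
  have hrad2 : 2 ≤ rad a b c := habc.two_le_rad
  obtain ⟨ha, hb, hsum, -⟩ := habc
  have hc : 0 < c := by omega
  have hn0 : a * b * c ≠ 0 := by positivity
  set n : ℕ := a * b * c with hn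
  set R : ℝ := (rad a b c : ℝ) with hR
  have hR1 : (1 : ℝ) ≤ R := by rw [hR]; exact_mod_cast le_trans (by norm_num) hrad2
  have hR0 : 0 < R := one_pos.trans_le hR1
  have hRε4 : 1 ≤ R ^ (ε / 4) := Real.one_le_rpow hR1 (by positivity)
  have hRε40 : 0 ≤ R ^ (ε / 4) := zero_le_one.trans hRε4
  -- log n ≤ 3 log c ≤ 3 κ' R^{ε/4}
  have hcR : (0 : ℝ) < c := by exact_mod_cast hc
  have hnle : (n : ℝ) ≤ (c : ℝ) ^ 3 := by
    have hac : a ≤ c := by omega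
    have hbc : b ≤ c := by omega
    have : a * b * c ≤ c ^ 3 := by
      calc a * b * c ≤ c * c * c := by gcongr
        _ = c ^ 3 := by ring
    rw [← hn] at this
    exact_mod_cast this
  have hnpos : (0 : ℝ) < n := by exact_mod_cast Nat.pos_of_ne_zero hn0
  have hlogn : Real.log n ≤ 3 * Real.log c := by
    have := Real.log_le_log hnpos hnle
    rwa [Real.log_pow, Nat.cast_ofNat] at this
  have hlogc' : Real.log c ≤ κ' * R ^ (ε / 4) :=
    hlogc.trans (mul_le_mul_of_nonneg_right (le_max_left _ _) hRε40)
  -- M := log n / log 2 ≤ Q := (3 κ'/log 2) R^{ε/4}, Q ≥ 1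
  set Q : ℝ := 3 * κ' / Real.log 2 * R ^ (ε / 4) with hQ
  have h3 : 1 ≤ 3 * κ' / Real.log 2 := by
    rw [le_div_iff₀ hlog2]
    have : Real.log 2 < 1 := by have := Real.log_two_lt_d9; linarith
    linarith
  have hQ1 : 1 ≤ Q := one_le_mul_of_one_le_of_one_le h3 hRε4
  have hMQ : Real.log n / Real.log 2 ≤ Q := by
    rw [div_le_iff₀ hlog2, hQ]
    calc Real.log n ≤ 3 * Real.log c := hlogn
      _ ≤ 3 * (κ' * R ^ (ε / 4)) := by linarith
      _ = 3 * κ' / Real.log 2 * R ^ (ε / 4) * Real.log 2 := by field_simp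
  have hmaxMQ : max (Real.log n / Real.log 2) 1 ≤ Q := max_le hMQ hQ1
  have hmaxM0 : 0 ≤ max (Real.log n / Real.log 2) 1 := zero_le_one.trans (le_max_right _ _)
  have hP : ((∏ p ∈ n.primeFactors, n.factorization p : ℕ) : ℝ) ≤ (max (Real.log n / Real.log 2) 1) ^ 4 :=
    prod_factorization_le hn0 hcard
  calc ((∏ p ∈ n.primeFactors, n.factorization p : ℕ) : ℝ) ≤ (max (Real.log n / Real.log 2) 1) ^ 4 := hP
    _ ≤ Q ^ 4 := pow_le_pow_left₀ hmaxM0 hmaxMQ 4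
    _ = (3 * κ' / Real.log 2) ^ 4 * (R ^ (ε / 4)) ^ 4 := by rw [hQ, mul_pow]
    _ = (3 * κ' / Real.log 2) ^ 4 * R ^ ε := by
        congr 1
        rw [← Real.rpow_natCast, ← Real.rpow_mul hR0.le]
        norm_num

end Summit.ABC.ABC.Theorems.FewPrimeValuationProduct

end
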